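import Literature.MathematicalPhysics.QuantumLattice.StrongExpDecayBoundaryInfluenceCube
import Literature.Probability.LatticeModels.DobrushinShlosmanShellTelescoping
import HarnessLib

/-!
# Exponential decay of correlations gives the Dobrushin–Shlosman window hypotheses for cube kernels
# (Chatterjee, CMP 385 (2021), §§7–8 in dual form)

S. Chatterjee, *A probabilistic mechanism for quark confinement*, CMP **385** (2021) [Chatterjee2021], proves his
Theorem 2.4 (Def. 2.3 ⇒ unbroken centre symmetry) by a COUPLING of two cube theories with different boundary
conditions whose disagreement is confined near the disagreeing boundary links (Lemma 8.1, built on the total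
variation bound Cor. 7.6), iterated over randomly placed cubes in a slab (§§9–11). The tree runs the same scheme in
the DUAL, observable, form of Dobrushin–Shlosman's window comparison (`DobrushinShlosmanUniquenessBulk.lean`),
whose two inputs for the WINDOW kernels — here the Wilson kernels `γ_Λ(·|η) = ymSpecification ρ β Λ η` of the
interior link set `Λ` of a cube `v + {0,…,M}^d` — are proved in this file, for EVERY compact metrisable gauge
group (no connectedness):

* **locality** `integral_ymSpecification_cube_congr`: on `Λ`-local observables the cube kernel reads the boundary
  condition only on the links of the cube (every plaquette through an interior link lies in the cube,
  `mem_cube_of_mem_closure_interior`);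
* **(H1), the one-boundary-link influence array** `abs_integral_sub_integral_le_cube_influence`: for boundary
  conditions `ω, η` differing at ONE link `y ∉ Λ` and a bounded measurable `Λ`-local `f` with `|f σ − f τ| ≤ δ x`
  whenever `σ = τ` off `x`,
  `|γ_Λ f(ω) − γ_Λ f(η)| ≤ Σ_{x ∈ Λ} K(y,x) δ x`, `K(y,x) = κ(⌊‖x − y‖_∞⌋)` if `y` is a link of the cube and `0`
  otherwise, for ANY profile `κ : ℕ → ℝ≥0` dominating the trivial bound `2` on the shells `≤ 4` and Chatterjee's
  Cor. 7.4 cube bound `e^{2c̄} 2 d (4r+1)^d e^{2c̄} K₁ e^{−2K₂ r}`, `r = ⌊(j−1)/4⌋`, on the shells `j ≥ 5`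
  (`abs_integral_update_sub_le_of_strongExpDecayZd_cube`). Proof: the shell telescoping
  `DobrushinShlosman.abs_integral_sub_integral_le_sum_shells` over the sup-distance to `y` — the dual of
  Chatterjee's Lemma 8.1 coupling, with a DECAYING disagreement profile instead of the printed two-zone one.

## References
* S. Chatterjee, CMP 385 (2021), arXiv:2006.16229: §7 Cor. 7.4 / 7.6, §8 Lemma 8.1.
* R. L. Dobrushin, S. B. Shlosman (1985), Thm. 1, condition `C_V`.
-/

noncomputable section

open MeasureTheory Filter Function
open scoped Topology

namespace Literature.MathematicalPhysics.QuantumLattice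

open Literature.Probability.LatticeModels
open Literature.Probability.LatticeModels.DobrushinShlosman (abs_integral_sub_integral_le_sum_shells)

section Cube

variable {d N : ℕ} {G : Type*} [Group G] [TopologicalSpace G] [IsTopologicalGroup G]
  [CompactSpace G] [MeasurableSpace G] [BorelSpace G] [SecondCountableTopology G] [T2Space G]
  (ρ : G →* Matrix (Fin N) (Fin N) ℂ)

omit [TopologicalSpace G] [IsTopologicalGroup G] [CompactSpace G] [MeasurableSpace G] [BorelSpace G]
  [SecondCountableTopology G] [T2Space G] [Group G] in
/-- Two points of the box `v + {0,…,M}^d` are at sup-distance `≤ M`. [folklore] -/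
private theorem norm_sub_le_of_mem_box {v a b : Fin d → ℤ} {M : ℕ}
    (ha : ∀ j, v j ≤ a j ∧ a j ≤ v j + M) (hb : ∀ j, v j ≤ b j ∧ b j ≤ v j + M) :
    ‖a - b‖ ≤ (M : ℝ) := by
  refine (pi_norm_le_iff_of_nonneg (Nat.cast_nonneg M)).2 fun j => ?_
  rw [Pi.sub_apply, Int.norm_eq_abs]
  have h1 := ha j
  have h2 := hb j
  push_cast
  have e1 : ((v j : ℤ) : ℝ) ≤ a j := by exact_mod_cast h1.1
  have e2 : ((a j : ℤ) : ℝ) ≤ v j + M := by exact_mod_cast h1.2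
  have e3 : ((v j : ℤ) : ℝ) ≤ b j := by exact_mod_cast h2.1
  have e4 : ((b j : ℤ) : ℝ) ≤ v j + M := by exact_mod_cast h2.2
  rw [abs_le]
  constructor <;> linarith

omit [TopologicalSpace G] [IsTopologicalGroup G] [CompactSpace G] [BorelSpace G]
  [SecondCountableTopology G] [T2Space G] [Group G] in
/-- Under two probability measures the averages of a `[−1,1]`-valued function differ by at most `2`. [folklore] -/
private theorem abs_integral_sub_integral_le_two' {μ ν : Measure (LGConfig d G)} [IsProbabilityMeasure μ]
    [IsProbabilityMeasure ν] {h : LGConfig d G → ℝ} (h1 : ∀ σ, |h σ| ≤ 1) :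
    |(∫ σ, h σ ∂μ) - ∫ σ, h σ ∂ν| ≤ 2 := by
  have hμ : |∫ σ, h σ ∂μ| ≤ 1 := by
    have := norm_integral_le_of_norm_le_const (μ := μ) (f := h) (C := 1)
      (ae_of_all _ fun σ => by rw [Real.norm_eq_abs]; exact h1 σ)
    simpa using this
  have hν : |∫ σ, h σ ∂ν| ≤ 1 := by
    have := norm_integral_le_of_norm_le_const (μ := ν) (f := h) (C := 1)
      (ae_of_all _ fun σ => by rw [Real.norm_eq_abs]; exact h1 σ)
    simpa using this
  calc |(∫ σ, h σ ∂μ) - ∫ σ, h σ ∂ν| ≤ |∫ σ, h σ ∂μ| + |∫ σ, h σ ∂ν| := abs_sub _ _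
    _ ≤ 1 + 1 := add_le_add hμ hν
    _ = 2 := by norm_num

/-! ### §1 Locality of the cube kernels -/

omit [T2Space G] in
/-- **Locality of the cube kernels** (Chatterjee 2021 §7: the kernel of the interior links of a cube is the
lattice gauge theory in the cube with a boundary condition; Seiler LNP 159 Ch. 2): for the interior link set `Λ`
of the cube `v + {0,…,M}^d` and a bounded measurable `Λ`-local `f`, `∫ f dγ_Λ(·|ζ)` depends on `ζ` only through
the links of the cube — every plaquette through an interior link lies in the cube. [cite: Chatterjee2021, §7 (lattice gauge theory in a cube)] -/
theorem integral_ymSpecification_cube_congr (hρ : Continuous ρ) (β : ℝ) {M : ℕ} {v : Fin d → ℤ}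
    {Λ : Finset (ZdEdge d)}
    (hΛ : Λ = (((Fintype.piFinset fun j : Fin d => Finset.Icc (v j) (v j + M)) ×ˢ
        (Finset.univ : Finset (Fin d))).filter fun e =>
          e.1 e.2 + 1 ≤ v e.2 + M ∧ ∀ j, j ≠ e.2 → v j < e.1 j ∧ e.1 j < v j + M))
    {f : LGConfig d G → ℝ} (hfm : Measurable f) (hfdep : DependsOn f (↑Λ : Set (ZdEdge d)))
    {ζ ζ' : LGConfig d G}
    (hζ : ∀ u : ZdEdge d, (∀ j, v j ≤ u.1 j ∧ u.1 j ≤ v j + M) → u.1 u.2 + 1 ≤ v u.2 + M → ζ u = ζ' u) :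
    ∫ U, f U ∂(ymSpecification ρ β Λ ζ) = ∫ U, f U ∂(ymSpecification ρ β Λ ζ') := by
  refine integral_ymSpecification_congr_of_eqOn ρ hρ β Λ (S := Λ) hfm hfdep fun e heΛ he => ?_
  rcases he with he | he
  · obtain ⟨h1, h2⟩ := mem_cube_of_mem_closure_interior hΛ he
    exact hζ e h1 h2
  · exact absurd he heΛ

/-! ### §2 The one-boundary-link influence array of a cube kernel (H1) -/

/-- ★ **Exponential decay of correlations gives the Dobrushin–Shlosman one-boundary-link contraction for cube
kernels, with a decaying influence profile** (Chatterjee 2021, Cor. 7.4 / Lemma 8.1 in dual form). Data: Def. 2.3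
with constants `K₁, K₂` (`K₂ ≥ 0`), `|Re tr ρ(U_p)| ≤ C`; the cube `v + {0,…,M}^d` with interior link set `Λ`; a
profile `κ : ℕ → ℝ`, `κ ≥ 0`, with `κ j ≥ 2` for `j ≤ 4` and
`κ j ≥ e^{2c̄}·2·d(4r+1)^d·e^{2c̄} K₁ e^{−2K₂ r}`, `r = ⌊(j−1)/4⌋`, `c̄ = |β|·2C·2(d−1)`, for `j ≥ 5`. Then for a
link `y ∉ Λ`, boundary conditions `ω, η` agreeing off `y`, and a bounded measurable `Λ`-local `f` with
`|f σ − f τ| ≤ δ x` whenever `σ = τ` off `x` (`δ ≥ 0`):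
`|∫ f dγ_Λ(·|ω) − ∫ f dγ_Λ(·|η)| ≤ Σ_{x ∈ Λ} K(y,x) δ x`, where `K(y,x) = κ ⌊‖x − y‖_∞⌋` if `y` is a link of the
cube and `K(y,x) = 0` otherwise (then the two kernels agree on `f`, by locality).
Proof: shell telescoping over `⌊‖x − y‖_∞⌋` (`DobrushinShlosman.abs_integral_sub_integral_le_sum_shells`), the far
shells `j ≥ 5` being controlled by Cor. 7.4 on the cube with `r = ⌊(j−1)/4⌋` (`4r < j`, `4r ≤ M`), the near ones
trivially. [cite: Chatterjee2021, Cor. 7.4 and Lemma 8.1] -/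
theorem abs_integral_sub_integral_le_cube_influence [NeZero d] (hρ : Continuous ρ) {C : ℝ}
    (hC0 : 0 ≤ C) (hC : ∀ (x : Site d) (i j : Fin d) (U : LGConfig d G), |plaquetteObs ρ x i j U| ≤ C)
    {β K₁ K₂ : ℝ} (hdecay : StrongExpDecayZd d ρ β K₁ K₂) (hK₂ : 0 ≤ K₂) (M : ℕ) (v : Fin d → ℤ)
    (Λ : Finset (ZdEdge d))
    (hΛ : Λ = (((Fintype.piFinset fun j : Fin d => Finset.Icc (v j) (v j + M)) ×ˢ
        (Finset.univ : Finset (Fin d))).filter fun e =>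
          e.1 e.2 + 1 ≤ v e.2 + M ∧ ∀ j, j ≠ e.2 → v j < e.1 j ∧ e.1 j < v j + M))
    (κ : ℕ → ℝ) (hκ0 : ∀ j, 0 ≤ κ j) (hκ2 : ∀ j, j ≤ 4 → 2 ≤ κ j)
    (hκE : ∀ j, 5 ≤ j → Real.exp (2 * (|β| * (2 * C * (2 * (d - 1 : ℕ) : ℕ)))) *
        (2 * ((d * (4 * ((j - 1) / 4) + 1) ^ d : ℕ) *
          (Real.exp (2 * (|β| * (2 * C * (2 * (d - 1 : ℕ) : ℕ)))) *
            (K₁ * Real.exp (-(K₂ * (2 * ((j - 1) / 4 : ℕ)))))))) ≤ κ j)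
    (y : ZdEdge d) (hy : y ∉ Λ) (ω η : LGConfig d G) (hωη : ∀ e, e ≠ y → ω e = η e)
    {f : LGConfig d G → ℝ} (hfm : Measurable f) {B : ℝ} (hfB : ∀ U, |f U| ≤ B)
    (hfdep : DependsOn f (↑Λ : Set (ZdEdge d))) {δ : ZdEdge d → ℝ} (hδ0 : ∀ x, 0 ≤ δ x)
    (hδ : ∀ (x : ZdEdge d) (σ τ : LGConfig d G), (∀ e, e ≠ x → σ e = τ e) → |f σ - f τ| ≤ δ x) :
    |(∫ U, f U ∂(ymSpecification ρ β Λ ω)) - ∫ U, f U ∂(ymSpecification ρ β Λ η)| ≤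
      ∑ x ∈ Λ, (if (∀ j, v j ≤ y.1 j ∧ y.1 j ≤ v j + M) ∧ y.1 y.2 + 1 ≤ v y.2 + M
        then κ ⌊‖x.1 - y.1‖⌋₊ else 0) * δ x := by
  classical
  have hγ := QuantumFieldTheory.isSpecification_ymSpecification_of_t2Space (d := d) ρ hρ β
  haveI := hγ.isProbability Λ ω
  haveI := hγ.isProbability Λ η
  by_cases hyc : (∀ j, v j ≤ y.1 j ∧ y.1 j ≤ v j + M) ∧ y.1 y.2 + 1 ≤ v y.2 + M
  · -- `y` is a boundary link of the cube: shell telescoping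
    simp only [if_pos hyc]
    have hηupd : η = Function.update ω y (η y) := by
      funext e
      by_cases hey : e = y
      · subst hey; simp
      · rw [Function.update_of_ne hey, hωη e hey]
    -- interior links are within sup-distance `M` of `y`
    have hdist : ∀ x ∈ Λ, ⌊‖x.1 - y.1‖⌋₊ ≤ M := by
      intro x hx
      rw [hΛ] at hx
      simp only [Finset.mem_filter, Finset.mem_product, Fintype.mem_piFinset, Finset.mem_Icc,
        Finset.mem_univ, and_true] at hx
      have h := norm_sub_le_of_mem_box hx.1 hyc.1
      exact (Nat.floor_le_floor h).trans (Nat.floor_natCast M).le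
    refine abs_integral_sub_integral_le_sum_shells Λ (fun x => ⌊‖x.1 - y.1‖⌋₊) κ ?_ hfm hfB hfdep hδ0 hδ
    intro j h hhm hh1 hhdep
    by_cases hj : j ≤ 4
    · exact (abs_integral_sub_integral_le_two' hh1).trans (hκ2 j hj)
    · replace hj : 5 ≤ j := by omega
      by_cases hjM : M < j
      · -- empty shell: `h` is constant
        have hconst : ∀ σ τ, h σ = h τ := fun σ τ =>
          hhdep fun x hx => absurd (hx.2.trans (hdist x hx.1)) (not_le.2 hjM)
        have e1 : ∫ σ, h σ ∂(ymSpecification ρ β Λ ω) = h ω := by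
          rw [show (fun σ => h σ) = fun _ => h ω from funext fun σ => hconst σ ω]
          simp
        have e2 : ∫ σ, h σ ∂(ymSpecification ρ β Λ η) = h ω := by
          rw [show (fun σ => h σ) = fun _ => h ω from funext fun σ => hconst σ ω]
          simp
        rw [e1, e2, sub_self, abs_zero]
        exact hκ0 j
      · replace hjM : j ≤ M := not_lt.1 hjM
        set r : ℕ := (j - 1) / 4 with hr
        have hr1 : 1 ≤ r := by omega
        have h4r : 4 * r + 1 ≤ j := by omega
        have hrM : 4 * r ≤ M := by omega
        -- `h` reads only links at sup-distance `> 4r` from `y`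
        have hhdep' : DependsOn h {u : ZdEdge d | (4 * r : ℝ) < ‖u.1 - y.1‖} := by
          refine hhdep.mono fun x hx => ?_
          obtain ⟨-, hxj⟩ := hx
          have h0 : (0 : ℝ) ≤ ‖x.1 - y.1‖ := norm_nonneg _
          have hxj' : (j : ℝ) ≤ ‖x.1 - y.1‖ := (Nat.le_floor_iff h0).1 hxj
          have h4r' : ((4 * r + 1 : ℕ) : ℝ) ≤ j := by exact_mod_cast h4r
          push_cast at h4r'
          show (4 * r : ℝ) < ‖x.1 - y.1‖
          linarith
        have key := abs_integral_update_sub_le_of_strongExpDecayZd_cube ρ hρ hC0 hC hdecay hK₂ M v Λ hΛ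
          ω y hyc.1 hyc.2 hy r hr1 hrM (η y) hhm hh1 hhdep'
        rw [← hηupd] at key
        rw [abs_sub_comm]
        exact key.trans (hκE j hj)
  · -- `y` is not a link of the cube: the kernels agree on `f`
    simp only [if_neg hyc, zero_mul, Finset.sum_const_zero]
    rw [integral_ymSpecification_cube_congr ρ hρ β hΛ hfm hfdep (ζ := ω) (ζ' := η) fun u hu1 hu2 =>
      hωη u fun huy => hyc (huy ▸ ⟨hu1, hu2⟩), sub_self, abs_zero]

end Cube

end Literature.MathematicalPhysics.QuantumLattice

end
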